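import Summits.QuantumFields.YangMills.Theorems.BalabanUVNodesN15KingModelToronBlockCovariance
import Mathlib.Topology.Instances.Matrix
import Mathlib.Analysis.Normed.Ring.Units
import HarnessLib

/-!
# BalabanUVNodes ∕ N15 — THE KING-MODEL RUNG (PART Ͻ-i): CONTINUITY IN THE TORON — King's fine operator, the covariant block mean, the full propagator, the effective Laplacian
# and THE BLOCK-FIELD COVARIANCE `(Δ^ω_eff)⁻¹` DEPEND CONTINUOUSLY ON THE PHASE VECTOR `ω` at every unit `ω₀` (the letters are polynomial in `ω, ω̄`; inverses are continuous at
# invertible matrices) — the analytic half of the density step «finite-order torons are dense ⇒ estimates at all torons» (PART Ͻ-j)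
# (Track A, DAG node N15 = NE2; FAN-OUT v1.1 §N15 s3 «KING-MODEL RUNG … + what the curved case adds»; count-neutral)

HONEST FRAMING.  Count-neutral (cell `pub-ymgap`, seat `pub-ymgap-dag-n15-e` g45; `--supports stmt-QuantumFields-27247 --as helper` = K3ᴬ, KEY MAP v3).  Elementary topology of
finite-dimensional matrix functions of the phase vector of a constant abelian link field in King's `A = 0` model [King1986]; compare PART Ϛ (analyticity in the link field,
[Balaban1985BackgroundPropagators] §3.B p.399 l.37–40, for the FINE covariance) — here only continuity, but for the BLOCK-SPIN objects too.  NOT Bałaban's `G_k(U)`; NOT a node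
discharge; nothing continuum ∕ ℝ⁴ ∕ OS ∕ Clay.

PROVED HERE:
* §1 ★ `continuous_toronOp` (entries affine in `ω_μ`, `ω̄_μ`: Ͷ-a `toronOp_apply` + Ͱ-a `covLapF_apply`), `continuous_twPow`, ★ `continuous_QsOpTw`, `continuous_kingQadjTw`, ★ `continuous_fineOpTw`;
* §2 `continuousAt_matrix_mul_of` (rectangular products), `continuousAt_matrix_inv_of_isUnit` ∕ `continuousAt_inv_of` (over `ℂ`), ★★ `continuousAt_fineOpTw_inv` (unit `ω₀`, `a, c ≥ 0`, `m² > 0`), ★★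
  **`continuousAt_effLapTw`**, ★★★ **`continuousAt_effLapTw_inv`** (`a > 0`), ★★ `continuousAt_effLapTw_inv_apply` (entries), ★ `continuousAt_toronOp_inv`∕`_apply` (the fine covariance);
* §3 sequential form: ★★ **`tendsto_effLapTw_inv_apply`** — along any sequence of phase vectors `ω_j → ω₀` (unit `ω₀`), `(Δ^{ω_j}_eff)⁻¹(b,b′) → (Δ^{ω₀}_eff)⁻¹(b,b′)`; and for two spacings
  `tendsto_effLapTw_inv_sub_apply`.
PRIOR TREE ART (by name): Ͷ-a (`toronOp`, `toronOp_apply`, `toronLink_apply`), Ͱ-a (`covLapF_apply`), Ͷ-k (`kingQadjTw`, `fineOpTw`, `effLapTw`, `isUnit_fineOpTw`), Ͷ-n (`isUnit_effLapTw`),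
Ͷ-a (`toronOp_posDef`), `B5ToronOperators118` (`QsOpTw`, `twPow`), Mathlib (`continuous_matrix`, `Continuous.matrix_mul`, `Continuous.matrix_conjTranspose`, `continuousAt_matrix_inv`,
`NormedRing.inverse_continuousAt`, `ContinuousAt.prodMk`).  Dedup (rg at filing): basename 0 files; needles `continuous_toronOp|continuousAt_effLapTw|continuous_QsOpTw|tendsto_effLapTw`
0 tree files.  presearch: n/a (elementary).  Locators: [King1986] (2.13)–(2.14) p.653, (4.4)–(4.5) p.670; [Balaban1985BackgroundPropagators] (3.19) p.393, (3.23) p.394, §3.B p.399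
l.37–40.  0 `sorry`, 0 `def`.
-/

noncomputable section

open scoped BigOperators ComplexConjugate ComplexOrder Topology
open Finset Matrix Filter

namespace Summit.QuantumFields.YangMills.BalabanUVNodes.N15KingModelRung.Cover

open Literature.MathematicalPhysics.QuantumFieldTheory.Balaban1983to89.B5Prop11Plancherel (Tor unitVec fine)
open Literature.MathematicalPhysics.QuantumFieldTheory.Balaban1983to89.B5ToronOperators118 (QsOpTw twPow)
open Summit.QuantumFields.YangMills.BalabanUVNodes.N15KingModelRung.Toron (toronOp toronOp_apply toronLink toronLink_apply toronOp_posDef kingQadjTw fineOpTw effLapTw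
  isUnit_fineOpTw isUnit_effLapTw)
open Summit.QuantumFields.YangMills.BalabanUVNodes.N15KingModelRung.Covariant (covLapF_apply)

variable {d : ℕ}

/-! ## §1 The letters are continuous in the phase vector -/

section Letters

variable (K : Fin (d + 1) → ℕ) [hK : ∀ μ, NeZero (K μ)]

/-- An `if`-gated value of a continuous function (condition independent of the variable) is continuous. [folklore] -/
theorem continuous_ite_const {X : Type*} [TopologicalSpace X] (p : Prop) [Decidable p] {f : X → ℂ} (hf : Continuous f) :
    Continuous fun x => if p then f x else 0 := by
  by_cases hp : p
  · simp only [hp, if_true]; exact hf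
  · simp only [hp, if_false]; exact continuous_const

/-- ★ **KING's FINE OPERATOR AT A TORON IS CONTINUOUS IN THE PHASE VECTOR** (its entries are affine in `ω_μ` and `ω̄_μ`). [cite: King1986, (4.4) p.670; Balaban1985BackgroundPropagators, (3.23) p.394] -/
theorem continuous_toronOp (c m2 : ℝ) : Continuous fun ω : Fin (d + 1) → ℂ => toronOp K c m2 ω := by
  refine continuous_matrix fun x y => ?_
  simp only [toronOp_apply, covLapF_apply, toronLink_apply, Matrix.conjTranspose_apply]
  refine Continuous.sub continuous_const (Continuous.mul continuous_const (continuous_finsetSum _ fun μ _ => ?_))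
  refine Continuous.add (continuous_ite_const _ (continuous_apply μ)) (continuous_ite_const _ ?_)
  exact (continuous_apply μ).star

variable (N : ℕ) [NeZero N] (M : Fin (d + 1) → ℕ) [hM : ∀ μ, NeZero (M μ)]

omit [NeZero N] in
/-- The transport phase `ω^j = Π_ν ω_ν^{j_ν}` is continuous in `ω`. [cite: Balaban1985BackgroundPropagators, (3.19) p.393] -/
theorem continuous_twPow (j : Fin (d + 1) → Fin N) : Continuous fun ω : Fin (d + 1) → ℂ => twPow N ω j := by
  unfold twPow
  exact continuous_finsetProd _ fun ν _ => (continuous_apply ν).pow _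

omit [NeZero N] hM in
/-- ★ THE COVARIANT BLOCK MEAN IS CONTINUOUS IN THE PHASE VECTOR. [cite: Balaban1985BackgroundPropagators, (3.19) p.393; King1986, (2.11) p.653] -/
theorem continuous_QsOpTw : Continuous fun ω : Fin (d + 1) → ℂ => QsOpTw N M ω := by
  refine continuous_matrix fun y x => ?_
  simp only [QsOpTw]
  exact continuous_finsetSum _ fun j _ => continuous_ite_const _ ((continuous_twPow N j).div_const _)

omit [NeZero N] hM in
/-- King's `η`-adjoint is continuous in the phase vector. [cite: King1986, (2.13) p.653] -/
theorem continuous_kingQadjTw : Continuous fun ω : Fin (d + 1) → ℂ => kingQadjTw N M ω := by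
  unfold kingQadjTw
  exact ((continuous_QsOpTw N M).matrix_conjTranspose).const_smul ((N : ℂ) ^ (d + 1))

/-- ★ KING's FULL FINE OPERATOR AT THE TORON IS CONTINUOUS IN THE PHASE VECTOR. [cite: King1986, (2.13) p.653] -/
theorem continuous_fineOpTw (a c m2 : ℝ) : Continuous fun ω : Fin (d + 1) → ℂ => fineOpTw N M a c m2 ω := by
  unfold fineOpTw
  exact (continuous_toronOp (fine N M) c m2).add (((continuous_kingQadjTw N M).matrix_mul (continuous_QsOpTw N M)).const_smul (a : ℂ))

end Letters

/-! ## §2 Inverses: continuity at every unit phase vector -/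

section Inverses

/-- Rectangular matrix products of functions continuous AT A POINT are continuous at the point. [folklore] -/
theorem continuousAt_matrix_mul_of {X : Type*} [TopologicalSpace X] {l m n : Type*} [Fintype l] [Fintype m] [Fintype n] {f : X → Matrix l m ℂ} {g : X → Matrix m n ℂ}
    {x : X} (hf : ContinuousAt f x) (hg : ContinuousAt g x) : ContinuousAt (fun x => f x * g x) x := by
  have hmul : Continuous (fun p : Matrix l m ℂ × Matrix m n ℂ => p.1 * p.2) := continuous_fst.matrix_mul continuous_snd
  exact hmul.continuousAt.comp (hf.prodMk hg)

/-- Matrix inversion over `ℂ` is continuous at every invertible matrix. [folklore] -/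
theorem continuousAt_matrix_inv_of_isUnit {n : Type*} [Fintype n] [DecidableEq n] {A : Matrix n n ℂ} (hA : IsUnit A) : ContinuousAt Inv.inv A := by
  refine continuousAt_matrix_inv A ?_
  obtain ⟨u, hu⟩ := (Matrix.isUnit_iff_isUnit_det A).mp hA
  rw [← hu]
  exact NormedRing.inverse_continuousAt u

/-- The inverse of a matrix function continuous at a point with invertible value is continuous at the point. [folklore] -/
theorem continuousAt_inv_of {X : Type*} [TopologicalSpace X] {n : Type*} [Fintype n] [DecidableEq n] {f : X → Matrix n n ℂ} {x : X} (hf : ContinuousAt f x)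
    (hu : IsUnit (f x)) : ContinuousAt (fun x => (f x)⁻¹) x :=
  (continuousAt_matrix_inv_of_isUnit hu).comp hf

variable (N : ℕ) [NeZero N] (M : Fin (d + 1) → ℕ) [hM : ∀ μ, NeZero (M μ)]

/-- ★★ KING's FULL PROPAGATOR `G(ω) = A₀(ω)⁻¹` IS CONTINUOUS IN `ω` AT EVERY UNIT PHASE VECTOR (`a, c ≥ 0`, `m² > 0`). [cite: King1986, (2.13) p.653] -/
theorem continuousAt_fineOpTw_inv {a c m2 : ℝ} (ha : 0 ≤ a) (hc : 0 ≤ c) (hm : 0 < m2) {ω₀ : Fin (d + 1) → ℂ} (hω₀ : ∀ μ, ‖ω₀ μ‖ = 1) :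
    ContinuousAt (fun ω : Fin (d + 1) → ℂ => (fineOpTw N M a c m2 ω)⁻¹) ω₀ :=
  continuousAt_inv_of (continuous_fineOpTw N M a c m2).continuousAt (isUnit_fineOpTw N M ha hc hm hω₀)

/-- ★★ **KING's EFFECTIVE LAPLACIAN AT THE TORON IS CONTINUOUS IN `ω` AT EVERY UNIT PHASE VECTOR.** [cite: King1986, (2.14) p.653, (4.5) p.670] -/
theorem continuousAt_effLapTw {a c m2 : ℝ} (ha : 0 ≤ a) (hc : 0 ≤ c) (hm : 0 < m2) {ω₀ : Fin (d + 1) → ℂ} (hω₀ : ∀ μ, ‖ω₀ μ‖ = 1) :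
    ContinuousAt (fun ω : Fin (d + 1) → ℂ => effLapTw N M a c m2 ω) ω₀ := by
  unfold effLapTw
  have h3 : ContinuousAt (fun ω : Fin (d + 1) → ℂ => QsOpTw N M ω * (fineOpTw N M a c m2 ω)⁻¹ * kingQadjTw N M ω) ω₀ :=
    continuousAt_matrix_mul_of (continuousAt_matrix_mul_of (continuous_QsOpTw N M).continuousAt (continuousAt_fineOpTw_inv N M ha hc hm hω₀))
      (continuous_kingQadjTw N M).continuousAt
  exact ContinuousAt.sub continuousAt_const (h3.const_smul ((a : ℂ) ^ 2))

/-- ★★★ **THE BLOCK-FIELD COVARIANCE `(Δ^ω_eff)⁻¹` IS CONTINUOUS IN `ω` AT EVERY UNIT PHASE VECTOR** (`a > 0`, `c ≥ 0`, `m² > 0`). [cite: King1986, (2.16) p.653, (4.38) p.674] -/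
theorem continuousAt_effLapTw_inv {a c m2 : ℝ} (ha : 0 < a) (hc : 0 ≤ c) (hm : 0 < m2) {ω₀ : Fin (d + 1) → ℂ} (hω₀ : ∀ μ, ‖ω₀ μ‖ = 1) :
    ContinuousAt (fun ω : Fin (d + 1) → ℂ => (effLapTw N M a c m2 ω)⁻¹) ω₀ :=
  continuousAt_inv_of (continuousAt_effLapTw N M ha.le hc hm hω₀) (isUnit_effLapTw N M ha hc hm hω₀)

/-- ★★ Entrywise: `ω ↦ (Δ^ω_eff)⁻¹(b,b′)` is continuous at every unit `ω₀`. [cite: King1986, (4.38) p.674] -/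
theorem continuousAt_effLapTw_inv_apply {a c m2 : ℝ} (ha : 0 < a) (hc : 0 ≤ c) (hm : 0 < m2) {ω₀ : Fin (d + 1) → ℂ} (hω₀ : ∀ μ, ‖ω₀ μ‖ = 1) (b b' : Tor M) :
    ContinuousAt (fun ω : Fin (d + 1) → ℂ => (effLapTw N M a c m2 ω)⁻¹ b b') ω₀ :=
  ((continuous_id.matrix_elem b b').continuousAt).comp (continuousAt_effLapTw_inv N M ha hc hm hω₀)

variable (K : Fin (d + 1) → ℕ) [hK : ∀ μ, NeZero (K μ)]

/-- ★ The fine toron covariance `G_ω = (−cΔ_ω + m²)⁻¹` is continuous in `ω` at every unit `ω₀` (`c ≥ 0`, `m² > 0`). [cite: King1986, (4.4) p.670; Balaban1985BackgroundPropagators, §3.B p.399 l.37–40] -/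
theorem continuousAt_toronOp_inv {c m2 : ℝ} (hc : 0 ≤ c) (hm : 0 < m2) {ω₀ : Fin (d + 1) → ℂ} (hω₀ : ∀ μ, ‖ω₀ μ‖ = 1) :
    ContinuousAt (fun ω : Fin (d + 1) → ℂ => (toronOp K c m2 ω)⁻¹) ω₀ :=
  continuousAt_inv_of (continuous_toronOp K c m2).continuousAt (toronOp_posDef K hc hm hω₀).isUnit

/-- Entrywise continuity of the fine toron covariance. [cite: King1986, (4.4) p.670] -/
theorem continuousAt_toronOp_inv_apply {c m2 : ℝ} (hc : 0 ≤ c) (hm : 0 < m2) {ω₀ : Fin (d + 1) → ℂ} (hω₀ : ∀ μ, ‖ω₀ μ‖ = 1) (x y : Tor K) :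
    ContinuousAt (fun ω : Fin (d + 1) → ℂ => (toronOp K c m2 ω)⁻¹ x y) ω₀ :=
  ((continuous_id.matrix_elem x y).continuousAt).comp (continuousAt_toronOp_inv K hc hm hω₀)

end Inverses

/-! ## §3 Sequential form (for the density step) -/

section Sequential

variable (N : ℕ) [NeZero N] (M : Fin (d + 1) → ℕ) [hM : ∀ μ, NeZero (M μ)]

/-- ★★ **ALONG ANY SEQUENCE OF PHASE VECTORS CONVERGING TO A UNIT ONE, THE BLOCK-FIELD COVARIANCE ENTRIES CONVERGE.** [cite: King1986, (4.38) p.674] -/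
theorem tendsto_effLapTw_inv_apply {a c m2 : ℝ} (ha : 0 < a) (hc : 0 ≤ c) (hm : 0 < m2) {ω₀ : Fin (d + 1) → ℂ} (hω₀ : ∀ μ, ‖ω₀ μ‖ = 1)
    {ωs : ℕ → Fin (d + 1) → ℂ} (hωs : Tendsto ωs atTop (𝓝 ω₀)) (b b' : Tor M) :
    Tendsto (fun j => (effLapTw N M a c m2 (ωs j))⁻¹ b b') atTop (𝓝 ((effLapTw N M a c m2 ω₀)⁻¹ b b')) :=
  (continuousAt_effLapTw_inv_apply N M ha hc hm hω₀ b b').tendsto.comp hωs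

/-- ★★ Two spacings: the DIFFERENCE of the block-field covariances converges along simultaneous approximations of the two phase vectors. [cite: King1986, Lemma 4.5 (4.38) p.674] -/
theorem tendsto_effLapTw_inv_sub_apply (N₁ N₂ : ℕ) [NeZero N₁] [NeZero N₂] {a₁ a₂ c₁ c₂ m2 : ℝ} (ha₁ : 0 < a₁) (ha₂ : 0 < a₂) (hc₁ : 0 ≤ c₁) (hc₂ : 0 ≤ c₂) (hm : 0 < m2)
    {ω₁ ω₂ : Fin (d + 1) → ℂ} (hω₁ : ∀ μ, ‖ω₁ μ‖ = 1) (hω₂ : ∀ μ, ‖ω₂ μ‖ = 1) {ωs₁ ωs₂ : ℕ → Fin (d + 1) → ℂ}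
    (h₁ : Tendsto ωs₁ atTop (𝓝 ω₁)) (h₂ : Tendsto ωs₂ atTop (𝓝 ω₂)) (b b' : Tor M) :
    Tendsto (fun j => (effLapTw N₁ M a₁ c₁ m2 (ωs₁ j))⁻¹ b b' - (effLapTw N₂ M a₂ c₂ m2 (ωs₂ j))⁻¹ b b') atTop
      (𝓝 ((effLapTw N₁ M a₁ c₁ m2 ω₁)⁻¹ b b' - (effLapTw N₂ M a₂ c₂ m2 ω₂)⁻¹ b b')) :=
  (tendsto_effLapTw_inv_apply N₁ M ha₁ hc₁ hm hω₁ h₁ b b').sub (tendsto_effLapTw_inv_apply N₂ M ha₂ hc₂ hm hω₂ h₂ b b')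

/-- ★★ **LIMIT FORM OF AN ESTIMATE**: if along approximations `ωs₁ → ω₁`, `ωs₂ → ω₂` (unit limits) the norm of the covariance difference is bounded by a constant `B`, then so it is
at the limit. [folklore] -/
theorem norm_effLapTw_inv_sub_apply_le_of_tendsto (N₁ N₂ : ℕ) [NeZero N₁] [NeZero N₂] {a₁ a₂ c₁ c₂ m2 : ℝ} (ha₁ : 0 < a₁) (ha₂ : 0 < a₂) (hc₁ : 0 ≤ c₁) (hc₂ : 0 ≤ c₂)
    (hm : 0 < m2) {ω₁ ω₂ : Fin (d + 1) → ℂ} (hω₁ : ∀ μ, ‖ω₁ μ‖ = 1) (hω₂ : ∀ μ, ‖ω₂ μ‖ = 1) {ωs₁ ωs₂ : ℕ → Fin (d + 1) → ℂ}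
    (h₁ : Tendsto ωs₁ atTop (𝓝 ω₁)) (h₂ : Tendsto ωs₂ atTop (𝓝 ω₂)) (b b' : Tor M) {B : ℝ}
    (hB : ∀ j, ‖(effLapTw N₁ M a₁ c₁ m2 (ωs₁ j))⁻¹ b b' - (effLapTw N₂ M a₂ c₂ m2 (ωs₂ j))⁻¹ b b'‖ ≤ B) :
    ‖(effLapTw N₁ M a₁ c₁ m2 ω₁)⁻¹ b b' - (effLapTw N₂ M a₂ c₂ m2 ω₂)⁻¹ b b'‖ ≤ B :=
  le_of_tendsto' ((tendsto_effLapTw_inv_sub_apply M N₁ N₂ ha₁ ha₂ hc₁ hc₂ hm hω₁ hω₂ h₁ h₂ b b').norm) hB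

/-- Limit form for the covariance itself. [folklore] -/
theorem norm_effLapTw_inv_apply_le_of_tendsto {a c m2 : ℝ} (ha : 0 < a) (hc : 0 ≤ c) (hm : 0 < m2) {ω₀ : Fin (d + 1) → ℂ} (hω₀ : ∀ μ, ‖ω₀ μ‖ = 1)
    {ωs : ℕ → Fin (d + 1) → ℂ} (hωs : Tendsto ωs atTop (𝓝 ω₀)) (b b' : Tor M) {B : ℝ} (hB : ∀ j, ‖(effLapTw N M a c m2 (ωs j))⁻¹ b b'‖ ≤ B) :
    ‖(effLapTw N M a c m2 ω₀)⁻¹ b b'‖ ≤ B :=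
  le_of_tendsto' ((tendsto_effLapTw_inv_apply N M ha hc hm hω₀ hωs b b').norm) hB

end Sequential

end Summit.QuantumFields.YangMills.BalabanUVNodes.N15KingModelRung.Cover

end
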